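import Mathlib.NumberTheory.Padics.RingHoms
import Literature.NumberTheory.EllipticCurves.TwoIsogenySelmerGroup
import Literature.NumberTheory.EllipticCurves.BinaryQuarticLocalSolubility
import HarnessLib

/-!
# Route IsogenyRedei, crux `PencilSelmerDictionary` (stmt-Parity-11584), line
# `toric-node-vacuity-cassels`: the `2`-adic table on the `b`-side (Stub C)

For the pencil `E_t : y² = x³ + 2t x² + (t² + 1) x` and a positive divisor `d ∣ t² + 1`, the
`b`-side homogeneous space of the `2`-isogeny descent is the binary quartic
`q(u, z) = d u⁴ + 2t u² z² + e z⁴`, `e = (t² + 1)/d`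
(`Literature.NumberTheory.EllipticCurves.twoIsogenyQuartic (2t) d e = ⟨d, 0, 2t, 0, e⟩`).
We prove that its `ℚ₂`-solubility is the explicit Boolean function of `(d mod 16, t mod 8)`

* `d` odd:  `d ≡ 1 (mod 8)`, or `d ≡ 5 (mod 8)` and `t ≡ 1, 2 (mod 4)`;
* `d` even: `d/2 ≡ 1 (mod 8)` and (`t ≡ 1 (mod 4)` or `t ≡ 7 (mod 8)`), or
            `d/2 ≡ 5 (mod 8)` and (`t ≡ 1 (mod 4)` or `t ≡ 3 (mod 8)`).

## Proof

Mechanism: `d · q(u, z) = (d u² + t z²)² + z⁴`, so at a point of an affine chart (`z = 1` or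
`u = 1`) of `ℙ¹(ℤ₂)` the value `q` has `2`-adic valuation `≤ 1`; a square value is therefore a
unit square, i.e. `q ≡ 1 (mod 8)`. Hence `q` is `ℚ₂`-soluble iff some chart value at a residue
`x mod 16` is `≡ 1 (mod 8)`, a condition on the residues `(d, t, e) mod 16`, which are tied by
`d e ≡ t² + 1`. Formally:

* (⇒) a `ℚ₂`-point gives (`exists_zmod_of_isSoluble_padic_of_dvd`, reduction of a chart point
  modulo `16`) a solution of `w² = q(1, x)` or `w² = q(x, 1)` in `ZMod 16`; the finite statement
  `table_of_sq_mod16` (all residue triples `D E = T² + 1` in `ZMod 16`, by `decide`) turns this into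
  the table for `(D.val, T.val) = (d mod 16, t mod 16)`, and `omega` translates to `(d, t)`.
* (⇐) the finite statement `one_mod8_of_table` (by `decide`) produces from the table a residue `x`
  with `q(x, 1)` or `q(1, x)` in `{1, 9} ⊂ ZMod 16`; lifting `x` to `X : ℤ` gives
  `q(X, 1) ≡ 1 (mod 8)` (or `q(1, X) ≡ 1 (mod 8)`), and Hensel at `2` (`isSoluble_two_of_dvd`,
  `k = 0`, `w = 1`) gives a `ℚ₂`-point.

The generic tools (`eval_twoIsogenyQuartic`, `map_map_intCast`, `eval_map_intCast`,
`exists_zmod_of_isSoluble_padic(_of_dvd)`, `norm_intCast_eq_one_of_odd`, `isSoluble_two_of_dvd`)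
are private copies of the line's shared tools file.

## References

* J. H. Silverman, *The Arithmetic of Elliptic Curves*, 2nd ed., GTM 106 (2009), X.4.9.
  [cite: SilvermanAEC2009, Prop. X.4.9]
-/

noncomputable section

open scoped Classical

namespace Summit.Parity.BatemanHorn.Theorems.PencilSelmerDictionary

open Literature.NumberTheory.EllipticCurves
open Literature.NumberTheory.EllipticCurves.BinaryQuartic

/-! ## Private copies of the shared tools -/

/-- The value of the integral form: `q(u, z) = d u⁴ + a u²z² + d' z⁴`. [folklore] -/
private theorem eval_twoIsogenyQuartic (a d d' u z : ℤ) :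
    (twoIsogenyQuartic a d d').eval u z = d * u ^ 4 + a * u ^ 2 * z ^ 2 + d' * z ^ 4 := by
  simp only [twoIsogenyQuartic, BinaryQuartic.eval]
  ring

/-- Functoriality of `map` on integral forms: mapping along `ℤ → R → S` is mapping along `ℤ → S`.
[folklore] -/
private theorem map_map_intCast {R S : Type*} [CommRing R] [CommRing S] (f : BinaryQuartic ℤ)
    (g : R →+* S) : (f.map (Int.castRingHom R)).map g = f.map (Int.castRingHom S) := by
  ext <;> simp [BinaryQuartic.map]

/-- Evaluation of an integral form commutes with casting the arguments. [folklore] -/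
private theorem eval_map_intCast {R : Type*} [CommRing R] (f : BinaryQuartic ℤ) (x y : ℤ) :
    (f.map (Int.castRingHom R)).eval (x : R) (y : R) = ((f.eval x y : ℤ) : R) := by
  have := eval_map (Int.castRingHom R) f x y
  simpa using this

/-- **Residue exhaustion engine.** If the integral form `f` has a `ℚ_p`-point then, for every `n`,
`w² = f(1, x)` or `w² = f(x, 1)` is soluble in `ZMod (p ^ n)` (scale the point into a chart of
`ℙ¹(ℤ_p)` and reduce modulo `p ^ n`). [folklore] -/
private theorem exists_zmod_of_isSoluble_padic {p : ℕ} [Fact p.Prime] (n : ℕ)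
    (f : BinaryQuartic ℤ) (h : (f.map (Int.castRingHom ℚ_[p])).IsSoluble) :
    ∃ x w : ZMod (p ^ n),
      w ^ 2 = (f.map (Int.castRingHom (ZMod (p ^ n)))).eval 1 x ∨
        w ^ 2 = (f.map (Int.castRingHom (ZMod (p ^ n)))).eval x 1 := by
  rw [← map_intCast_map_coe] at h
  have hφ : ∀ t z : ℤ_[p], ∀ u v : ℤ_[p],
      z ^ 2 = (f.map (Int.castRingHom ℤ_[p])).eval u v →
        (PadicInt.toZModPow n z) ^ 2 =
          (f.map (Int.castRingHom (ZMod (p ^ n)))).eval (PadicInt.toZModPow n u)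
            (PadicInt.toZModPow n v) := by
    intro t z u v hz
    have := congrArg (PadicInt.toZModPow n) hz
    rw [map_pow, ← eval_map, map_map_intCast] at this
    exact this
  rcases (isSoluble_map_coe_iff _).mp h with ⟨t, z, htz⟩ | ⟨t, z, htz⟩
  · refine ⟨PadicInt.toZModPow n t, PadicInt.toZModPow n z, Or.inl ?_⟩
    simpa using hφ t z 1 t htz
  · refine ⟨PadicInt.toZModPow n t, PadicInt.toZModPow n z, Or.inr ?_⟩
    simpa using hφ t z t 1 htz

/-- **Residue exhaustion engine, concrete modulus.** If the integral form `f` has a `ℚ_p`-point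
and `m ∣ p ^ n`, then `w² = f(1, x)` or `w² = f(x, 1)` is soluble in `ZMod m`. [folklore] -/
private theorem exists_zmod_of_isSoluble_padic_of_dvd {p : ℕ} [Fact p.Prime] {m n : ℕ}
    (hm : m ∣ p ^ n) (f : BinaryQuartic ℤ) (h : (f.map (Int.castRingHom ℚ_[p])).IsSoluble) :
    ∃ x w : ZMod m,
      w ^ 2 = (f.map (Int.castRingHom (ZMod m))).eval 1 x ∨
        w ^ 2 = (f.map (Int.castRingHom (ZMod m))).eval x 1 := by
  obtain ⟨x, w, hxw⟩ := exists_zmod_of_isSoluble_padic n f h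
  have hφ : ∀ u v : ZMod (p ^ n), w ^ 2 = (f.map (Int.castRingHom (ZMod (p ^ n)))).eval u v →
      (ZMod.castHom hm (ZMod m) w) ^ 2 =
        (f.map (Int.castRingHom (ZMod m))).eval (ZMod.castHom hm (ZMod m) u)
          (ZMod.castHom hm (ZMod m) v) := by
    intro u v huv
    have := congrArg (ZMod.castHom hm (ZMod m)) huv
    rw [map_pow, ← eval_map, map_map_intCast] at this
    exact this
  refine ⟨ZMod.castHom hm (ZMod m) x, ZMod.castHom hm (ZMod m) w, ?_⟩
  rcases hxw with hxw | hxw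
  · left
    have := hφ 1 x hxw
    rwa [map_one] at this
  · right
    have := hφ x 1 hxw
    rwa [map_one] at this

/-- An odd integer is a `2`-adic unit. [folklore] -/
private theorem norm_intCast_eq_one_of_odd {w : ℤ} (hw : Odd w) : ‖((w : ℤ_[2]))‖ = 1 := by
  rcases (PadicInt.norm_le_one (w : ℤ_[2])).lt_or_eq with h | h
  · exfalso
    rw [PadicInt.norm_int_lt_one_iff_dvd] at h
    have h2 : (2 : ℤ) ∣ w := by exact_mod_cast h
    exact (Int.not_even_iff_odd.mpr hw) (even_iff_two_dvd.mpr h2)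
  · exact h

/-- **`2`-adic solubility from an approximate point** (Hensel): if `(x, y) ≠ (0, 0)` are integers
and `f(x, y) ≡ 4^k · w² (mod 2^{2k+3})` with `w` odd, then `f(x, y) = 4^k (w² + 8m)` is a square in
`ℤ₂`, so `f` is `ℚ₂`-soluble. [folklore] -/
private theorem isSoluble_two_of_dvd (f : BinaryQuartic ℤ) {x y : ℤ} (hxy : x ≠ 0 ∨ y ≠ 0) (k : ℕ)
    {w : ℤ} (hw : Odd w) (h : (2 : ℤ) ^ (2 * k + 3) ∣ f.eval x y - 4 ^ k * w ^ 2) :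
    (f.map (Int.castRingHom ℚ_[2])).IsSoluble := by
  obtain ⟨m, hm⟩ := h
  have hval : f.eval x y = 4 ^ k * (w ^ 2 + 8 * m) := by
    have h48 : (2 : ℤ) ^ (2 * k + 3) = 4 ^ k * 8 := by
      rw [pow_add, pow_mul]; norm_num
    rw [h48] at hm
    linear_combination hm
  -- `w² + 8m` is a square in `ℤ₂`
  obtain ⟨s, hs⟩ : ∃ s : ℤ_[2], s ^ 2 = ((w ^ 2 + 8 * m : ℤ) : ℤ_[2]) := by
    apply exists_sq_eq_of_norm_sub_lt (z := ((w : ℤ) : ℤ_[2]))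
    have hwn : ‖((w : ℤ) : ℤ_[2])‖ = 1 := norm_intCast_eq_one_of_odd hw
    have h2 : ‖(2 : ℤ_[2])‖ = 2⁻¹ := by
      have := PadicInt.norm_p (p := 2)
      exact_mod_cast this
    have hsub :
        ((w : ℤ) : ℤ_[2]) ^ 2 - ((w ^ 2 + 8 * m : ℤ) : ℤ_[2]) = ((-(8 * m) : ℤ) : ℤ_[2]) := by
      push_cast; ring
    rw [hsub, norm_mul, h2, hwn, mul_one]
    have hle : ‖((-(8 * m) : ℤ) : ℤ_[2])‖ ≤ (2 : ℝ) ^ (-(3 : ℕ) : ℤ) :=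
      PadicInt.norm_int_le_pow_iff_dvd.mpr ⟨-m, by ring⟩
    calc ‖((-(8 * m) : ℤ) : ℤ_[2])‖ ≤ (2 : ℝ) ^ (-(3 : ℕ) : ℤ) := hle
      _ < (2⁻¹) ^ 2 := by norm_num
  -- the `ℤ₂`-point `(x, y, 2^k s)`
  rw [← map_intCast_map_coe]
  refine isSoluble_map_coe_of_eval_eq_sq _ (x := ((x : ℤ) : ℤ_[2])) (y := ((y : ℤ) : ℤ_[2]))
    (z := (2 : ℤ_[2]) ^ k * s) ?_ ?_
  · rcases hxy with hx | hy
    · exact Or.inl (by exact_mod_cast hx)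
    · exact Or.inr (by exact_mod_cast hy)
  · have h4 : (4 : ℤ_[2]) ^ k = (2 : ℤ_[2]) ^ (k * 2) := by
      rw [mul_comm, pow_mul]; norm_num
    rw [eval_map_intCast, hval, mul_pow, ← pow_mul, hs]
    push_cast
    rw [h4]

/-! ## The two finite statements over `ZMod 16` -/

/-- **Finite lemma 1** (insolubility half of the table). For residues `D E = T² + 1` in `ZMod 16`:
if a chart value `D x⁴ + 2T x² + E` or `D + 2T x² + E x⁴` is a square modulo `16` for some residue
`x`, then `(D.val, T.val)` passes the table. Exhaustion of the `192` residue triples. [folklore] -/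
private theorem table_of_sq_mod16 : ∀ D T E : ZMod 16, D * E = T ^ 2 + 1 →
    (∃ x : ZMod 16, (D * x ^ 4 + 2 * T * x ^ 2 + E) ∈ (Finset.univ.image fun w : ZMod 16 => w ^ 2) ∨
      (D + 2 * T * x ^ 2 + E * x ^ 4) ∈ (Finset.univ.image fun w : ZMod 16 => w ^ 2)) →
    ((D.val % 2 = 1 ∧ (D.val % 8 = 1 ∨ (D.val % 8 = 5 ∧ (T.val % 4 = 1 ∨ T.val % 4 = 2)))) ∨
      (D.val % 2 = 0 ∧ ((D.val / 2 % 8 = 1 ∧ (T.val % 4 = 1 ∨ T.val % 8 = 7)) ∨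
        (D.val / 2 % 8 = 5 ∧ (T.val % 4 = 1 ∨ T.val % 8 = 3))))) := by
  decide

/-- **Finite lemma 2** (solubility half of the table). For residues `D E = T² + 1` in `ZMod 16`:
if `(D.val, T.val)` passes the table then some chart value `D x⁴ + 2T x² + E` or `D + 2T x² + E x⁴`
is `1` or `9`, i.e. `≡ 1 (mod 8)`. Exhaustion of the `192` residue triples. [folklore] -/
private theorem one_mod8_of_table : ∀ D T E : ZMod 16, D * E = T ^ 2 + 1 →
    ((D.val % 2 = 1 ∧ (D.val % 8 = 1 ∨ (D.val % 8 = 5 ∧ (T.val % 4 = 1 ∨ T.val % 4 = 2)))) ∨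
      (D.val % 2 = 0 ∧ ((D.val / 2 % 8 = 1 ∧ (T.val % 4 = 1 ∨ T.val % 8 = 7)) ∨
        (D.val / 2 % 8 = 5 ∧ (T.val % 4 = 1 ∨ T.val % 8 = 3))))) →
    ∃ x : ZMod 16, (D * x ^ 4 + 2 * T * x ^ 2 + E = 1 ∨ D * x ^ 4 + 2 * T * x ^ 2 + E = 9) ∨
      (D + 2 * T * x ^ 2 + E * x ^ 4 = 1 ∨ D + 2 * T * x ^ 2 + E * x ^ 4 = 9) := by
  decide

/-! ## Glue: residues versus integers -/

/-- Dictionary between the integer-side table in `(d, t)` and the residue-side table in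
`((d : ZMod 16).val, (t : ZMod 16).val) = (d mod 16, t mod 16)`. [folklore] -/
private theorem table_iff_table_val (d : ℤ) (t : ℕ) :
    ((d % 2 = 1 ∧ (d % 8 = 1 ∨ (d % 8 = 5 ∧ (t % 4 = 1 ∨ t % 4 = 2)))) ∨
      (d % 2 = 0 ∧ ((d / 2 % 8 = 1 ∧ (t % 4 = 1 ∨ t % 8 = 7)) ∨
        (d / 2 % 8 = 5 ∧ (t % 4 = 1 ∨ t % 8 = 3))))) ↔
    (((d : ZMod 16).val % 2 = 1 ∧ ((d : ZMod 16).val % 8 = 1 ∨ ((d : ZMod 16).val % 8 = 5 ∧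
        (((t : ℕ) : ZMod 16).val % 4 = 1 ∨ ((t : ℕ) : ZMod 16).val % 4 = 2)))) ∨
      ((d : ZMod 16).val % 2 = 0 ∧ (((d : ZMod 16).val / 2 % 8 = 1 ∧
          (((t : ℕ) : ZMod 16).val % 4 = 1 ∨ ((t : ℕ) : ZMod 16).val % 8 = 7)) ∨
        ((d : ZMod 16).val / 2 % 8 = 5 ∧
          (((t : ℕ) : ZMod 16).val % 4 = 1 ∨ ((t : ℕ) : ZMod 16).val % 8 = 3))))) := by
  have hDv : (((d : ZMod 16).val : ℕ) : ℤ) = d % 16 := ZMod.val_intCast d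
  have hTv : ((t : ℕ) : ZMod 16).val = t % 16 := ZMod.val_natCast 16 t
  rw [hTv]
  generalize (d : ZMod 16).val = n at hDv ⊢
  omega

/-- Hensel glue, chart `(X : 1)`: if the value `f(X, 1)` of an integral form at an integer `X` is
`1` or `9` modulo `16` (so `≡ 1 (mod 8)`), then `f` is `ℚ₂`-soluble. [folklore] -/
private theorem isSoluble_two_of_eval_left_mod16 (f : BinaryQuartic ℤ) (X : ℤ)
    (h : ((f.eval X 1 : ℤ) : ZMod 16) = 1 ∨ ((f.eval X 1 : ℤ) : ZMod 16) = 9) :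
    (f.map (Int.castRingHom ℚ_[2])).IsSoluble := by
  have h16 : (16 : ℤ) ∣ f.eval X 1 - 1 ∨ (16 : ℤ) ∣ f.eval X 1 - 9 := by
    rcases h with h | h
    · left
      have := (ZMod.intCast_eq_intCast_iff_dvd_sub 1 (f.eval X 1) 16).mp (by rw [h]; norm_num)
      exact_mod_cast this
    · right
      have := (ZMod.intCast_eq_intCast_iff_dvd_sub 9 (f.eval X 1) 16).mp (by rw [h]; norm_num)
      exact_mod_cast this
  have h8 : (2 : ℤ) ^ (2 * 0 + 3) ∣ f.eval X 1 - 4 ^ 0 * 1 ^ 2 := by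
    norm_num
    rcases h16 with h16 | h16 <;> omega
  exact isSoluble_two_of_dvd f (Or.inr one_ne_zero) 0 odd_one h8

/-- Hensel glue, chart `(1 : X)`: if the value `f(1, X)` of an integral form at an integer `X` is
`1` or `9` modulo `16` (so `≡ 1 (mod 8)`), then `f` is `ℚ₂`-soluble. [folklore] -/
private theorem isSoluble_two_of_eval_right_mod16 (f : BinaryQuartic ℤ) (X : ℤ)
    (h : ((f.eval 1 X : ℤ) : ZMod 16) = 1 ∨ ((f.eval 1 X : ℤ) : ZMod 16) = 9) :
    (f.map (Int.castRingHom ℚ_[2])).IsSoluble := by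
  have h16 : (16 : ℤ) ∣ f.eval 1 X - 1 ∨ (16 : ℤ) ∣ f.eval 1 X - 9 := by
    rcases h with h | h
    · left
      have := (ZMod.intCast_eq_intCast_iff_dvd_sub 1 (f.eval 1 X) 16).mp (by rw [h]; norm_num)
      exact_mod_cast this
    · right
      have := (ZMod.intCast_eq_intCast_iff_dvd_sub 9 (f.eval 1 X) 16).mp (by rw [h]; norm_num)
      exact_mod_cast this
  have h8 : (2 : ℤ) ^ (2 * 0 + 3) ∣ f.eval 1 X - 4 ^ 0 * 1 ^ 2 := by
    norm_num
    rcases h16 with h16 | h16 <;> omega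
  exact isSoluble_two_of_dvd f (Or.inl one_ne_zero) 0 odd_one h8

/-! ## The `2`-adic table -/

/-- **The `2`-adic table on the `b`-side** (Stub C of line `toric-node-vacuity-cassels`). For
`t ≥ 1` and a positive squarefree `d ∣ t² + 1`, the homogeneous space
`w² = d u⁴ + 2t u²z² + ((t² + 1)/d) z⁴` of the `2`-isogeny descent of
`E_t : y² = x³ + 2t x² + (t² + 1) x` is `ℚ₂`-soluble iff: `d` odd and (`d ≡ 1 (mod 8)`, or
`d ≡ 5 (mod 8)` and `t ≡ 1, 2 (mod 4)`); or `d` even and (`d/2 ≡ 1 (mod 8)` and `t ≡ 1 (mod 4)` or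
`t ≡ 7 (mod 8)`, or `d/2 ≡ 5 (mod 8)` and `t ≡ 1 (mod 4)` or `t ≡ 3 (mod 8)`). Proof: chart values
of `q` have `2`-adic valuation `≤ 1` (`d q = (d u² + t z²)² + z⁴`), so solubility is decided modulo
`16` by the two finite lemmas `table_of_sq_mod16`, `one_mod8_of_table` and Hensel at `2`.
[cite: SilvermanAEC2009, Prop. X.4.9] -/
theorem stub_bSideTwoAdic :
    ∀ t : ℕ, 1 ≤ t → ∀ d : ℤ, 0 < d → Squarefree d → d ∣ (t : ℤ) ^ 2 + 1 →
      (((twoIsogenyQuartic (2 * (t : ℤ)) d (((t : ℤ) ^ 2 + 1) / d)).map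
          (Int.castRingHom ℚ_[2])).IsSoluble ↔
        ((d % 2 = 1 ∧ (d % 8 = 1 ∨ (d % 8 = 5 ∧ (t % 4 = 1 ∨ t % 4 = 2)))) ∨
          (d % 2 = 0 ∧ ((d / 2 % 8 = 1 ∧ (t % 4 = 1 ∨ t % 8 = 7)) ∨
            (d / 2 % 8 = 5 ∧ (t % 4 = 1 ∨ t % 8 = 3)))))) := by
  intro t _ d _ _ hdvd
  set e : ℤ := ((t : ℤ) ^ 2 + 1) / d with _he
  have he : d * e = (t : ℤ) ^ 2 + 1 := Int.mul_ediv_cancel' hdvd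
  -- the residues `D E = T² + 1` in `ZMod 16`
  have hDE : (d : ZMod 16) * (e : ZMod 16) = ((t : ℕ) : ZMod 16) ^ 2 + 1 := by
    have := congrArg (Int.cast : ℤ → ZMod 16) he
    push_cast at this
    exact this
  rw [table_iff_table_val d t]
  constructor
  · -- (⇒): reduce a chart point modulo `16` and exhaust
    intro hsol
    obtain ⟨x, w, hxw⟩ := exists_zmod_of_isSoluble_padic_of_dvd (p := 2) (m := 16) (n := 4)
      (by norm_num) _ hsol
    simp only [eval_map_twoIsogenyQuartic, eq_intCast, one_pow, mul_one, Int.cast_mul,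
      Int.cast_ofNat, Int.cast_natCast] at hxw
    refine table_of_sq_mod16 (d : ZMod 16) (t : ZMod 16) (e : ZMod 16) hDE ⟨x, ?_⟩
    rcases hxw with h | h
    · exact Or.inr (Finset.mem_image.mpr ⟨w, Finset.mem_univ _, h⟩)
    · exact Or.inl (Finset.mem_image.mpr ⟨w, Finset.mem_univ _, h⟩)
  · -- (⇐): a residue with chart value `≡ 1 (mod 8)`, then Hensel
    intro htab
    obtain ⟨x, hx⟩ := one_mod8_of_table (d : ZMod 16) (t : ZMod 16) (e : ZMod 16) hDE htab
    obtain ⟨X, rfl⟩ := ZMod.intCast_surjective x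
    have hV1 : (((twoIsogenyQuartic (2 * (t : ℤ)) d e).eval X 1 : ℤ) : ZMod 16) =
        (d : ZMod 16) * (X : ZMod 16) ^ 4 + 2 * ((t : ℕ) : ZMod 16) * (X : ZMod 16) ^ 2 +
          (e : ZMod 16) := by
      rw [eval_twoIsogenyQuartic]; push_cast; ring
    have hV2 : (((twoIsogenyQuartic (2 * (t : ℤ)) d e).eval 1 X : ℤ) : ZMod 16) =
        (d : ZMod 16) + 2 * ((t : ℕ) : ZMod 16) * (X : ZMod 16) ^ 2 +
          (e : ZMod 16) * (X : ZMod 16) ^ 4 := by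
      rw [eval_twoIsogenyQuartic]; push_cast; ring
    rcases hx with hx | hx
    · refine isSoluble_two_of_eval_left_mod16 _ X ?_
      rw [hV1]
      exact hx
    · refine isSoluble_two_of_eval_right_mod16 _ X ?_
      rw [hV2]
      exact hx

end Summit.Parity.BatemanHorn.Theorems.PencilSelmerDictionary

end
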